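import Literature.NumberTheory.ConnesConsani2021.CosineTail
import Literature.NumberTheory.ConnesConsani2021.SchwartzKernelsProofs
import Literature.NumberTheory.ConnesConsani2021.VanishingConditions
import Literature.NumberTheory.LFunctions.WeilDilationVirial
import Literature.NumberTheory.LFunctions.WeilMellinBounds
import Literature.NumberTheory.LFunctions.WeilArchimedeanMoments
import Literature.Analysis.FunctionSpaces.PlancherelL1L2
import Mathlib.Analysis.Calculus.ParametricIntegral
import HarnessLib

/-!
# Connes–Consani 2021, Prop. 2.2 (iii): the logarithmic moment of the cosine transform
# (`W_∞` half of the Hilbert–Schmidt identity, through `θ′`)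

A. Connes, C. Consani, *Weil positivity and trace formula, the archimedean place*, Selecta Math.
(N.S.) 27 (2021) 77 = arXiv:2006.13771 [bib: `ConnesConsani2021`], §1 (Lemma 1.3 `𝔽_{e_ℝ}^w = I∘u_∞^g`,
Lemma 1.4, Prop. 1.5 "the distribution `τ` is `W_ℝ = −W_∞`") and §2 (Prop. 2.2 (iii), Cor. 2.3, eq. (30):
`W_∞(f) = ∫ f̂(t) 2θ′(t) dt/2π`).

## What is proved (theorems only; no definitions without body, no named facts)

For a test function `g` (`IsWeilTest g`) let `T := cosTailFull g` (`CosineTail.lean`),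
`T(c) = ∫ g(v − c) e^{v/2}cos(2πe^v) dv` — the cosine transform of `x^{-1/2}g(log x)` in logarithmic
variables (`T(log w) = w^{1/2}∫₀^∞ x^{-1/2}g(log x)cos(2πwx)dx`).  Then:

* `mulFourier_cosTailFull` — **the spectral form of Lemma 1.3**: `T̂(t) = ½ u_∞(−t) ĝ(−t)` with
  `u_∞ = archUnitary = e^{2iθ}`, `ĝ = mulFourier g` (from the DISCHARGED `CC2021_lemma_6_holds`: `T` is
  `½ (I∘𝔽_{e_ℝ}^w)(g∘log)` read in the variable `c = −log λ`);
* `norm_cosTailFull_le_exp` — `‖T(c)‖ ≤ C e^{−|c|/2}` (one integration by parts against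
  `d sin(2πe^v)`), hence `T, cT ∈ L¹ ∩ L²`;
* (Plancherel `∫‖T‖² = ¼‖g‖₂²` is `CosineTailPlancherel.integral_norm_sq_cosTailFull`, seat gm-t15);
* **`cosTailFull_logMoment`** — the logarithmic moment
  `4 ∫_ℝ c ‖T(c)‖² dc = Re W_∞(g ∗ g*) − ∫ σ‖g(σ)‖² dσ`,
  `W_∞ = archW` (Bombieri's form) — proved on the spectral side: `(cT)^ = i dT̂/dt`,
  `u_∞′ = 2iθ′u_∞` (`hasDerivAt_riemannSiegelTheta_holds`), `ĝ′ = −i(σg)^`, polarized Plancherel, and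
  `W_∞(g ∗ g*) = (1/2π)∫|ĝ|² 2θ′` (`archW_eq_integral_mulFourier_thetaDeriv`, `mulFourier_autocorr`).
  This is where the principal value of `W_∞` lives in the Hilbert–Schmidt identity
  `4∫_{s≥0}∫‖cosTail g s c‖² = Re L(g ∗ g*)` behind Prop. 2.2 (iii): in `Γ′/Γ = ψ`, i.e. in `θ′`;
  no cut-off `Λ → ∞`, no `log Λ`, no Euler constant appears.

Label: RH-FREE archimedean analysis; bears_on W-C/W-P (K1 boundary fact `CC2021_prop_2_2_iii`, the
`W_∞` half of its kernel identity); nothing here bears on the truth of RH.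

## References
* A. Connes, C. Consani, arXiv:2006.13771: §1 Lemma 1.3 (arXiv Lemma 6) p. 7; Prop. 1.5 (iii)–(iv)
  (arXiv Prop. 8) p. 8; §2 Prop. 2.2 (iii), Cor. 2.3 and eq. (30) «lfourier» p. 10–11. [ConnesConsani2021]
* E. C. Titchmarsh, *Introduction to the Theory of Fourier Integrals*, Thm. 48 (Plancherel). [folklore]
-/

noncomputable section

open _root_.MeasureTheory Complex Set Filter Real FourierTransform
open scoped Real Topology ComplexConjugate ContDiff

namespace Literature.NumberTheory.ConnesConsani2021

open Literature.NumberTheory.LFunctions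

variable {g : ℝ → ℂ} {a : ℝ}

/-! ## §1. The lift `g ∘ log` to `(0, ∞)` as a test function on `ℝ₊*` -/

/-- On `(0,∞)`, the lift `v ↦ g(log v)` (extended by `0` to `v ≤ 0`, so that its support lies in
`(0,∞)` literally, as `CC2021_lemma_6` requires; cf. `mulLift`). [cite: ConnesConsani2021, §1 eq. (11) p. 7] -/
private theorem posLogLift_of_pos {v : ℝ} (hv : 0 < v) :
    (fun v : ℝ => if 0 < v then g (Real.log v) else 0) v = g (Real.log v) := if_pos hv

/-- The lift vanishes off `[e^{−a}, e^{a}]` when `supp g ⊆ [−a, a]`. [cite: ConnesConsani2021, §1 eq. (11) p. 7] -/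
private theorem posLogLift_eq_zero_of_notMem (hga : tsupport g ⊆ Icc (-a) a) {v : ℝ}
    (hv : v ∉ Icc (Real.exp (-a)) (Real.exp a)) :
    (fun v : ℝ => if 0 < v then g (Real.log v) else 0) v = 0 := by
  simp only
  split_ifs with h
  · refine image_eq_zero_of_notMem_tsupport fun hmem => hv ⟨?_, ?_⟩
    · have h1 := (hga hmem).1
      by_contra hlt
      have h2 : Real.log v < -a := by
        rw [← Real.log_exp (-a)]; exact Real.log_lt_log h (not_le.1 hlt)
      linarith
    · have h1 := (hga hmem).2
      by_contra hlt
      have h2 : a < Real.log v := by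
        rw [← Real.log_exp a]; exact Real.log_lt_log (Real.exp_pos a) (not_le.1 hlt)
      linarith
  · rfl

/-- The lift vanishes on `(−∞, e^{−a})`. [cite: ConnesConsani2021, §1 eq. (11) p. 7] -/
private theorem posLogLift_eq_zero_of_lt (hga : tsupport g ⊆ Icc (-a) a) {v : ℝ}
    (hv : v < Real.exp (-a)) : (fun v : ℝ => if 0 < v then g (Real.log v) else 0) v = 0 :=
  posLogLift_eq_zero_of_notMem hga fun h => not_le.2 hv h.1

/-- The lift has compact support. [cite: ConnesConsani2021, §1 eq. (11) p. 7] -/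
private theorem hasCompactSupport_posLogLift (hga : tsupport g ⊆ Icc (-a) a) :
    HasCompactSupport (fun v : ℝ => if 0 < v then g (Real.log v) else 0) :=
  HasCompactSupport.intro isCompact_Icc fun _ hv => posLogLift_eq_zero_of_notMem hga hv

/-- The (topological) support of the lift lies in `(0,∞)`. [cite: ConnesConsani2021, §1 eq. (11) p. 7] -/
private theorem tsupport_posLogLift_subset (hga : tsupport g ⊆ Icc (-a) a) :
    tsupport (fun v : ℝ => if 0 < v then g (Real.log v) else 0) ⊆ Ioi 0 := by
  have h1 : Function.support (fun v : ℝ => if 0 < v then g (Real.log v) else 0) ⊆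
      Icc (Real.exp (-a)) (Real.exp a) := by
    intro v hv
    by_contra h
    exact hv (posLogLift_eq_zero_of_notMem hga h)
  exact (closure_minimal h1 isClosed_Icc).trans fun v hv => (Real.exp_pos (-a)).trans_le hv.1

/-- The lift is smooth (it is `g ∘ log` on `(0,∞)` and `0` near `(−∞, 0]`).
[cite: ConnesConsani2021, §1 eq. (11) p. 7] -/
private theorem contDiff_posLogLift (hg : IsWeilTest g) (hga : tsupport g ⊆ Icc (-a) a) :
    ContDiff ℝ ∞ (fun v : ℝ => if 0 < v then g (Real.log v) else 0) := by
  refine contDiff_iff_contDiffAt.2 fun v => ?_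
  rcases lt_or_ge 0 v with hv | hv
  · -- on `(0,∞)` the lift is `g ∘ log`
    have h1 : ContDiffAt ℝ ∞ (fun w => g (Real.log w)) v :=
      (hg.1.contDiffAt).comp v (Real.contDiffAt_log.2 hv.ne')
    refine h1.congr_of_eventuallyEq ?_
    filter_upwards [Ioi_mem_nhds hv] with w hw
    exact posLogLift_of_pos hw
  · -- near `v ≤ 0` the lift vanishes identically
    have hev : (fun v : ℝ => if 0 < v then g (Real.log v) else 0) =ᶠ[𝓝 v] fun _ => 0 := by
      filter_upwards [Iio_mem_nhds (hv.trans_lt (Real.exp_pos (-a)))] with w hw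
      exact posLogLift_eq_zero_of_lt hga hw
    exact (contDiffAt_const (c := (0 : ℂ))).congr_of_eventuallyEq hev

/-- `𝔽_μ` of the lift is `ĝ`: `mellin (g∘log) (−is) = mulFourier g s` (eq. (11), the dictionary
`mulFourier_eq_mellin_mulLift`). [cite: ConnesConsani2021, §1 eq. (11) p. 7; App. A p. 30] -/
private theorem mellin_posLogLift (g : ℝ → ℂ) (s : ℝ) :
    mellin (fun v : ℝ => if 0 < v then g (Real.log v) else 0) (-(s * I)) = mulFourier g s := by
  rw [mulFourier_eq_mellin_mulLift]
  refine setIntegral_congr_fun measurableSet_Ioi fun v hv => ?_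
  simp only [if_pos (show (0:ℝ) < v from hv), mulLift]

/-! ## §2. `cosTailFull` is `½·archOp(lift)` in the variable `c = −log λ` -/

/-- The substitution `m = e^v` on `(0,∞)`: `∫_{(0,∞)} Φ(m) dm = ∫_ℝ e^v Φ(e^v) dv`. [folklore] -/
private theorem integral_Ioi_eq_integral_exp (Φ : ℝ → ℂ) :
    ∫ m in Ioi (0:ℝ), Φ m = ∫ v : ℝ, (Real.exp v : ℂ) * Φ (Real.exp v) := by
  have hcv := integral_image_eq_integral_abs_deriv_smul (s := univ) (f := Real.exp)
    (f' := Real.exp) MeasurableSet.univ (fun x _ => (Real.hasDerivAt_exp x).hasDerivWithinAt)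
    Real.exp_injective.injOn Φ
  rw [Set.image_univ, Real.range_exp] at hcv
  rw [hcv, setIntegral_univ]
  refine integral_congr_ae (Eventually.of_forall fun v => ?_)
  simp only [abs_of_pos (Real.exp_pos v), Complex.real_smul]

/-- **`T(c) = ½ (I ∘ 𝔽_{e_ℝ}^w)(ξ)(e^{−c})`**: the full cosine transform in logarithmic variables is
half the operator `archOp` (kernel `k^u = 2λ^{-1/2}μ^{1/2}cos(2πμ/λ)`, Lemma 1.4 (i)) applied to the
lift `ξ = g∘log`, at `λ = e^{−c}` (substitute `μ = e^v`: `k^u(e^{−c}, e^v)ξ(e^v)d*μ =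
2e^{c/2}e^{v/2}cos(2πe^{v+c})g(v)dv`). [cite: ConnesConsani2021, §1 Lemma 1.4 (i) (arXiv: Lemma 7 (i)) eq. (16) p. 7] -/
theorem cosTailFull_eq_half_archOp (g : ℝ → ℂ) (c : ℝ) :
    cosTailFull g c = (1 / 2 : ℂ) * archOp (fun v : ℝ => if 0 < v then g (Real.log v) else 0) (Real.exp (-c)) := by
  rw [cosTailFull_eq_integral_comp_add, archOp, integral_Ioi_eq_integral_exp, ← integral_const_mul]
  refine integral_congr_ae (Eventually.of_forall fun v => ?_)
  have hv := Real.exp_pos v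
  simp only [if_pos hv, Real.log_exp, archKernel, cosTailKernel]
  have hsq : Real.sqrt (Real.exp (-c)) = Real.exp (-c / 2) := by
    rw [Real.sqrt_eq_rpow, ← Real.exp_mul]; ring_nf
  have hsq' : Real.sqrt (Real.exp v) = Real.exp (v / 2) := by
    rw [Real.sqrt_eq_rpow, ← Real.exp_mul]; ring_nf
  rw [hsq, hsq']
  have h1 : (Real.exp (-c / 2))⁻¹ = Real.exp (c / 2) := by
    rw [← Real.exp_neg]; ring_nf
  rw [h1]
  have h2 : 2 * π * Real.exp v / Real.exp (-c) = 2 * π * Real.exp (v + c) := by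
    rw [Real.exp_add, Real.exp_neg]; field_simp
  rw [h2]
  have h3 : Real.exp ((v + c) / 2) = Real.exp (v / 2) * Real.exp (c / 2) := by
    rw [← Real.exp_add]; ring_nf
  rw [h3]
  have hne : (Real.exp v : ℂ) ≠ 0 := by exact_mod_cast hv.ne'
  push_cast
  field_simp

/-! ## §3. The spectral form of Lemma 1.3: `T̂(t) = ½ u_∞(−t) ĝ(−t)` -/

/-- `mulFourier` of a reflected function: `(c ↦ h(−c))^(s) = ĥ(−s)`. [folklore] -/
private theorem mulFourier_comp_neg (h : ℝ → ℂ) (s : ℂ) :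
    mulFourier (fun c => h (-c)) s = mulFourier h (-s) := by
  unfold mulFourier
  have e := integral_neg_eq_self (fun c : ℝ => h c * cexp (-(I * (-s) * (c : ℂ)))) volume
  rw [← e]
  refine integral_congr_ae (Eventually.of_forall fun c => ?_)
  push_cast
  ring_nf

/-- **Lemma 1.3 on the spectral side**: `mulFourier (cosTailFull g) t = ½·u_∞(−t)·ĝ(−t)`, i.e. the
Fourier transform (in `c`) of `T = cosTailFull g` is the multiplier `u_∞ = e^{2iθ}` times `ĝ`, read at
`−t` — `CC2021_lemma_6_holds` (`𝔽_μ(archOp ξ)(s) = u_∞(s)𝔽_μ(ξ)(s)`) for the lift `ξ = g∘log`, with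
`𝔽_μ(archOp ξ)(−is) = 2·T̂(−s)` (`T(c) = ½archOp ξ(e^{−c})`) and `𝔽_μ(ξ)(−is) = ĝ(s)`.
[cite: ConnesConsani2021, §1 Lemma 1.3 (arXiv: Lemma 6) p. 7 (chunk p0007:L76–L86); App. B p. 31] -/
theorem mulFourier_cosTailFull (hg : IsWeilTest g) (t : ℝ) :
    mulFourier (cosTailFull g) t = (1 / 2 : ℂ) * archUnitary (-t) * mulFourier g (-t) := by
  obtain ⟨a, hga⟩ : ∃ a : ℝ, tsupport g ⊆ Icc (-a) a := by
    obtain ⟨r, hr⟩ := hg.2.isCompact.isBounded.subset_closedBall 0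
    exact ⟨r, fun u hu => by simpa [Real.closedBall_eq_Icc] using hr hu⟩
  have L6 := CC2021_lemma_6_holds (fun v : ℝ => if 0 < v then g (Real.log v) else 0) (contDiff_posLogLift hg hga)
    (hasCompactSupport_posLogLift hga) (tsupport_posLogLift_subset hga) (-t)
  -- right-hand side of Lemma 6: `mellin ξ (−i(−t)) = ĝ(−t)`
  rw [mellin_posLogLift] at L6
  -- left-hand side: `mellin (archOp ξ)(−i(−t)) = 2·T̂(t)`
  have h1 := mulFourier_eq_mellin_mulLift (fun c => cosTailFull g (-c)) (-t)
  have h2 : mulFourier (fun c => cosTailFull g (-c)) ((-t : ℝ) : ℂ) = mulFourier (cosTailFull g) t := by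
    rw [mulFourier_comp_neg]
    push_cast
    rw [neg_neg]
  have h3 : mellin (mulLift fun c => cosTailFull g (-c)) (-(((-t : ℝ) : ℂ) * I)) =
      (1 / 2 : ℂ) * mellin (archOp (fun v : ℝ => if 0 < v then g (Real.log v) else 0)) (-(((-t : ℝ) : ℂ) * I)) := by
    have hc := mellin_const_smul (archOp (fun v : ℝ => if 0 < v then g (Real.log v) else 0)) (-(((-t : ℝ) : ℂ) * I)) (1 / 2 : ℂ)
    rw [smul_eq_mul] at hc
    rw [← hc]
    refine setIntegral_congr_fun measurableSet_Ioi fun l hl => ?_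
    have hl' : (0 : ℝ) < l := hl
    simp only [mulLift, cosTailFull_eq_half_archOp, neg_neg, Real.exp_log hl', smul_eq_mul]
  have hL : mellin (archOp (fun v : ℝ => if 0 < v then g (Real.log v) else 0)) (-(((-t : ℝ) : ℂ) * I)) =
      2 * mulFourier (cosTailFull g) t := by
    rw [← h2, h1, h3]; ring
  rw [hL] at L6
  push_cast at L6
  linear_combination (1 / 2 : ℂ) * L6

/-! ## §4. Decay of `T = cosTailFull g`: one integration by parts against `d sin(2πe^v)` -/

/-- `S(v) := sin(2πe^v)/(2π)` has derivative `e^v cos(2πe^v) = e^{v/2}K(v)`. [folklore] -/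
private theorem hasDerivAt_sinPrim (v : ℝ) :
    HasDerivAt (fun v : ℝ => Real.sin (2 * π * Real.exp v) / (2 * π))
      (Real.exp v * Real.cos (2 * π * Real.exp v)) v := by
  have h1 : HasDerivAt (fun v : ℝ => 2 * π * Real.exp v) (2 * π * Real.exp v) v :=
    (Real.hasDerivAt_exp v).const_mul (2 * π)
  have h2 : HasDerivAt (fun v : ℝ => Real.sin (2 * π * Real.exp v))
      (Real.cos (2 * π * Real.exp v) * (2 * π * Real.exp v)) v := (Real.hasDerivAt_sin _).comp v h1
  have hπ : (2 * π : ℝ) ≠ 0 := by positivity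
  refine (h2.div_const (2 * π)).congr_deriv ?_
  rw [div_eq_iff hπ]
  ring

/-- **Integration by parts**: `T(c) = −∫ (g′(u) − g(u)/2) e^{−(u+c)/2} S(u+c) du` with
`S(v) = sin(2πe^v)/(2π)` (so `|S| ≤ 1/2π`): the cosine kernel `K(v) = e^{v/2}cos(2πe^v)` is
`e^{−v/2}S′(v)`. [cite: ConnesConsani2021, §1 Lemma 1.4 (i) eq. (16) p. 7; Prop. 1.5 (iv) proof p. 9] -/
theorem cosTailFull_eq_neg_integral_deriv (hg : IsWeilTest g) (c : ℝ) :
    cosTailFull g c = -∫ u : ℝ, (deriv g u - g u * (1 / 2)) *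
      ((Real.exp (-(u + c) / 2) * (Real.sin (2 * π * Real.exp (u + c)) / (2 * π)) : ℝ) : ℂ) := by
  have hgc : Continuous g := hg.1.continuous
  have hgd : ∀ x, HasDerivAt g (deriv g x) x := fun x =>
    ((hg.1.differentiable (by simp)).differentiableAt).hasDerivAt
  have hg'c : Continuous (deriv g) := hg.1.continuous_deriv (by simp)
  have hg's : HasCompactSupport (deriv g) := hg.2.deriv
  -- `U(x) = g(x) e^{−(x+c)/2}`, `V(x) = S(x + c)` and their derivatives
  have hUd : ∀ x, HasDerivAt (fun x : ℝ => g x * (Real.exp (-(x + c) / 2) : ℂ))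
      ((deriv g x - g x * (1 / 2)) * (Real.exp (-(x + c) / 2) : ℂ)) x := by
    intro x
    have h1 : HasDerivAt (fun x : ℝ => -(x + c) / 2) (-1 / 2) x :=
      ((hasDerivAt_id' x).add_const c).neg.div_const 2
    have he : HasDerivAt (fun x : ℝ => (Real.exp (-(x + c) / 2) : ℂ))
        (((Real.exp (-(x + c) / 2) * (-1 / 2) : ℝ) : ℂ)) x :=
      ((Real.hasDerivAt_exp _).comp x h1).ofReal_comp
    refine ((hgd x).mul he).congr_deriv ?_
    push_cast
    ring
  have hVd : ∀ x, HasDerivAt (fun x : ℝ => ((Real.sin (2 * π * Real.exp (x + c)) / (2 * π) : ℝ) : ℂ))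
      (((Real.exp (x + c) * Real.cos (2 * π * Real.exp (x + c)) : ℝ) : ℂ)) x := by
    intro x
    have h1 : HasDerivAt (fun x : ℝ => x + c) 1 x := (hasDerivAt_id' x).add_const c
    have h2 := ((hasDerivAt_sinPrim (x + c)).comp x h1).ofReal_comp
    rw [mul_one] at h2
    exact h2
  -- continuity and compact support of the factors
  have cU : Continuous fun x : ℝ => g x * (Real.exp (-(x + c) / 2) : ℂ) := by fun_prop
  have cU' : Continuous fun x : ℝ => (deriv g x - g x * (1 / 2)) * (Real.exp (-(x + c) / 2) : ℂ) :=
    (hg'c.sub (hgc.mul continuous_const)).mul (by fun_prop)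
  have cV : Continuous fun x : ℝ =>
      ((Real.sin (2 * π * Real.exp (x + c)) / (2 * π) : ℝ) : ℂ) := by fun_prop
  have cV' : Continuous fun x : ℝ =>
      ((Real.exp (x + c) * Real.cos (2 * π * Real.exp (x + c)) : ℝ) : ℂ) := by fun_prop
  have sU : HasCompactSupport fun x : ℝ => g x * (Real.exp (-(x + c) / 2) : ℂ) := hg.2.mul_right
  have sU' : HasCompactSupport fun x : ℝ =>
      (deriv g x - g x * (1 / 2)) * (Real.exp (-(x + c) / 2) : ℂ) :=
    (hg's.sub hg.2.mul_right).mul_right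
  have hparts := integral_mul_deriv_eq_deriv_mul_of_integrable
    (u := fun x : ℝ => g x * (Real.exp (-(x + c) / 2) : ℂ))
    (v := fun x : ℝ => ((Real.sin (2 * π * Real.exp (x + c)) / (2 * π) : ℝ) : ℂ))
    (u' := fun x : ℝ => (deriv g x - g x * (1 / 2)) * (Real.exp (-(x + c) / 2) : ℂ))
    (v' := fun x : ℝ => ((Real.exp (x + c) * Real.cos (2 * π * Real.exp (x + c)) : ℝ) : ℂ))
    (fun x _ => hUd x) (fun x _ => hVd x)
    ((cU.mul cV').integrable_of_hasCompactSupport sU.mul_right)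
    ((cU'.mul cV).integrable_of_hasCompactSupport sU'.mul_right)
    ((cU.mul cV).integrable_of_hasCompactSupport sU.mul_right)
  -- the left side of `hparts` is `T(c)`, the right side is the claimed integral
  have hL : ∫ x : ℝ, g x * (Real.exp (-(x + c) / 2) : ℂ) *
      ((Real.exp (x + c) * Real.cos (2 * π * Real.exp (x + c)) : ℝ) : ℂ) = cosTailFull g c := by
    rw [cosTailFull_eq_integral_comp_add]
    refine integral_congr_ae (Eventually.of_forall fun x => ?_)
    simp only [cosTailKernel]
    have key : Real.exp (-(x + c) / 2) * Real.exp (x + c) = Real.exp ((x + c) / 2) := by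
      rw [← Real.exp_add]; ring_nf
    rw [← key]
    push_cast
    ring
  rw [← hL, hparts]
  congr 1
  refine integral_congr_ae (Eventually.of_forall fun x => ?_)
  push_cast
  ring

/-- The decay at `+∞`: `‖T(c)‖ ≤ C₁ e^{−c/2}` with `C₁ = (2π)⁻¹ ∫ ‖g′ − g/2‖ e^{−u/2}`. [cite: ConnesConsani2021, §1 Lemma 1.4 (i) p. 7; §2 Prop. 2.2 (iii) proof p. 10] -/
theorem norm_cosTailFull_le_exp_neg (hg : IsWeilTest g) :
    ∃ C : ℝ, ∀ c : ℝ, ‖cosTailFull g c‖ ≤ C * Real.exp (-c / 2) := by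
  have hgc : Continuous g := hg.1.continuous
  have hg'c : Continuous (deriv g) := hg.1.continuous_deriv (by simp)
  have hg's : HasCompactSupport (deriv g) := hg.2.deriv
  have hπ : 0 < 2 * π := by positivity
  -- the majorant `F(u) = ‖g′(u) − g(u)/2‖ e^{−u/2}/(2π)`
  have hFc : Continuous fun u : ℝ => ‖deriv g u - g u * (1 / 2)‖ * (Real.exp (-u / 2) / (2 * π)) :=
    (hg'c.sub (hgc.mul continuous_const)).norm.mul (by fun_prop)
  have hFs : HasCompactSupport fun u : ℝ => ‖deriv g u - g u * (1 / 2)‖ * (Real.exp (-u / 2) / (2 * π)) :=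
    (hg's.sub hg.2.mul_right).norm.mul_right
  have hFi : Integrable fun u : ℝ => ‖deriv g u - g u * (1 / 2)‖ * (Real.exp (-u / 2) / (2 * π)) :=
    hFc.integrable_of_hasCompactSupport hFs
  refine ⟨∫ u, ‖deriv g u - g u * (1 / 2)‖ * (Real.exp (-u / 2) / (2 * π)), fun c => ?_⟩
  rw [cosTailFull_eq_neg_integral_deriv hg c, norm_neg]
  calc ‖∫ u : ℝ, (deriv g u - g u * (1 / 2)) *
          ((Real.exp (-(u + c) / 2) * (Real.sin (2 * π * Real.exp (u + c)) / (2 * π)) : ℝ) : ℂ)‖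
      ≤ ∫ u : ℝ, ‖(deriv g u - g u * (1 / 2)) *
          ((Real.exp (-(u + c) / 2) * (Real.sin (2 * π * Real.exp (u + c)) / (2 * π)) : ℝ) : ℂ)‖ :=
        norm_integral_le_integral_norm _
    _ ≤ ∫ u : ℝ, ‖deriv g u - g u * (1 / 2)‖ * (Real.exp (-u / 2) / (2 * π)) * Real.exp (-c / 2) := by
        refine integral_mono_of_nonneg (Eventually.of_forall fun _ => norm_nonneg _)
          (hFi.mul_const _) (Eventually.of_forall fun u => ?_)
        simp only
        rw [norm_mul, Complex.norm_real, Real.norm_eq_abs, abs_mul, abs_of_pos (Real.exp_pos _),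
          abs_div, abs_of_pos hπ]
        have hs : |Real.sin (2 * π * Real.exp (u + c))| ≤ 1 := Real.abs_sin_le_one _
        have he : Real.exp (-(u + c) / 2) = Real.exp (-u / 2) * Real.exp (-c / 2) := by
          rw [← Real.exp_add]; ring_nf
        rw [he]
        have h0 : 0 ≤ ‖deriv g u - g u * (1 / 2)‖ * (Real.exp (-u / 2) * Real.exp (-c / 2)) := by
          positivity
        calc ‖deriv g u - g u * (1 / 2)‖ * (Real.exp (-u / 2) * Real.exp (-c / 2) *
              (|Real.sin (2 * π * Real.exp (u + c))| / (2 * π)))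
            = ‖deriv g u - g u * (1 / 2)‖ * (Real.exp (-u / 2) * Real.exp (-c / 2)) *
              (|Real.sin (2 * π * Real.exp (u + c))| / (2 * π)) := by ring
          _ ≤ ‖deriv g u - g u * (1 / 2)‖ * (Real.exp (-u / 2) * Real.exp (-c / 2)) * (1 / (2 * π)) :=
              mul_le_mul_of_nonneg_left (div_le_div_of_nonneg_right hs hπ.le) h0
          _ = ‖deriv g u - g u * (1 / 2)‖ * (Real.exp (-u / 2) / (2 * π)) * Real.exp (-c / 2) := by
              ring
    _ = (∫ u, ‖deriv g u - g u * (1 / 2)‖ * (Real.exp (-u / 2) / (2 * π))) * Real.exp (-c / 2) :=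
        integral_mul_const _ _

/-- **Two-sided decay**: `‖T(c)‖ ≤ C e^{−|c|/2}` (at `−∞` from `‖T(c)‖ ≤ e^{(c+a)/2}‖g‖₁`,
`norm_cosTailFull_le`; at `+∞` from the integration by parts). [cite: ConnesConsani2021, §1 Lemma 1.4 (i) p. 7; §2 Prop. 2.2 (iii) proof p. 10] -/
theorem norm_cosTailFull_le_exp_neg_abs (hg : IsWeilTest g) :
    ∃ C : ℝ, 0 ≤ C ∧ ∀ c : ℝ, ‖cosTailFull g c‖ ≤ C * Real.exp (-|c| / 2) := by
  obtain ⟨a, hga⟩ : ∃ a : ℝ, tsupport g ⊆ Icc (-a) a := by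
    obtain ⟨r, hr⟩ := hg.2.isCompact.isBounded.subset_closedBall 0
    exact ⟨r, fun u hu => by simpa [Real.closedBall_eq_Icc] using hr hu⟩
  obtain ⟨C₁, hC₁⟩ := norm_cosTailFull_le_exp_neg hg
  set C₂ : ℝ := Real.exp (a / 2) * ∫ u : ℝ, ‖g u‖ with hC₂
  refine ⟨max (max C₁ C₂) 0, le_max_right _ _, fun c => ?_⟩
  rcases le_or_gt 0 c with hc | hc
  · rw [abs_of_nonneg hc]
    exact (hC₁ c).trans (mul_le_mul_of_nonneg_right
      ((le_max_left _ _).trans (le_max_left _ _)) (Real.exp_pos _).le)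
  · rw [abs_of_neg hc]
    have h2 := norm_cosTailFull_le hg.1.continuous hg.2 hga c
    have he : Real.exp ((c + a) / 2) = Real.exp (a / 2) * Real.exp (-(-c) / 2) := by
      rw [← Real.exp_add]; ring_nf
    rw [he, mul_assoc, mul_comm (Real.exp (-(-c) / 2)), ← mul_assoc] at h2
    exact h2.trans (mul_le_mul_of_nonneg_right
      ((le_max_right _ _).trans (le_max_left _ _)) (Real.exp_pos _).le)

/-! ## §5. Integrability consequences -/

/-- `e^{−b|t|}` is integrable for `b > 0`. [folklore] -/
private theorem integrable_exp_neg_mul_abs' {b : ℝ} (hb : 0 < b) :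
    Integrable fun t : ℝ => Real.exp (-b * |t|) := by
  have hIoi : IntegrableOn (fun t : ℝ => Real.exp (-b * |t|)) (Ioi 0) := by
    refine (exp_neg_integrableOn_Ioi 0 hb).congr_fun (fun t ht => ?_) measurableSet_Ioi
    rw [abs_of_pos (mem_Ioi.1 ht)]
  have hIic : IntegrableOn (fun t : ℝ => Real.exp (-b * |t|)) (Iic 0) := by
    rw [← Measure.map_neg_eq_self (volume : Measure ℝ)]
    let m : MeasurableEmbedding fun x : ℝ => -x := (Homeomorph.neg ℝ).measurableEmbedding
    rw [m.integrableOn_map_iff]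
    simp_rw [Function.comp_def, abs_neg, neg_preimage, neg_Iic, neg_zero]
    exact Iff.mpr integrableOn_Ici_iff_integrableOn_Ioi hIoi
  have := hIic.union hIoi
  rwa [Iic_union_Ioi, integrableOn_univ] at this

/-- A continuous function with `‖f(c)‖ ≤ C(1 + |c|)e^{−|c|/2}`-type decay is integrable; here in the form
used below: `‖f(c)‖ ≤ C e^{−|c|/4}` ⇒ `f ∈ L¹`. [folklore] -/
private theorem integrable_of_norm_le_exp {E : Type*} [NormedAddCommGroup E] {f : ℝ → E}
    (hf : Continuous f) {C b : ℝ} (hb : 0 < b) (h : ∀ c, ‖f c‖ ≤ C * Real.exp (-b * |c|)) :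
    Integrable f :=
  Integrable.mono' ((integrable_exp_neg_mul_abs' hb).const_mul C) hf.aestronglyMeasurable
    (Eventually.of_forall h)

/-- `|c| e^{−|c|/4} ≤ 4`. [folklore] -/
private theorem abs_mul_exp_neg_le (c : ℝ) : |c| * Real.exp (-|c| / 4) ≤ 4 := by
  have h1 : |c| / 4 + 1 ≤ Real.exp (|c| / 4) := by
    have := Real.add_one_le_exp (|c| / 4); linarith
  have h2 : 0 < Real.exp (|c| / 4) := Real.exp_pos _
  have h3 : Real.exp (-|c| / 4) = (Real.exp (|c| / 4))⁻¹ := by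
    rw [← Real.exp_neg]; ring_nf
  rw [h3]
  have h4 : |c| ≤ 4 * Real.exp (|c| / 4) := by nlinarith [abs_nonneg c]
  calc |c| * (Real.exp (|c| / 4))⁻¹ ≤ 4 * Real.exp (|c| / 4) * (Real.exp (|c| / 4))⁻¹ :=
        mul_le_mul_of_nonneg_right h4 (inv_nonneg.2 h2.le)
    _ = 4 := by field_simp

section Integrability

variable (hg : IsWeilTest g)
include hg

/-- `T ∈ L¹`. [cite: ConnesConsani2021, §2 Prop. 2.2 (iii) proof p. 10] -/
theorem integrable_cosTailFull : Integrable (cosTailFull g) := by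
  obtain ⟨C, _, hC⟩ := norm_cosTailFull_le_exp_neg_abs hg
  refine integrable_of_norm_le_exp (continuous_cosTailFull hg.1.continuous hg.2) (b := 1 / 2)
    (C := C) (by norm_num) fun c => ?_
  convert hC c using 2; ring_nf

/-- `c T(c) ∈ L¹`. [cite: ConnesConsani2021, §2 Prop. 2.2 (iii) proof p. 10] -/
theorem integrable_mul_cosTailFull : Integrable fun c : ℝ => (c : ℂ) * cosTailFull g c := by
  obtain ⟨C, hC0, hC⟩ := norm_cosTailFull_le_exp_neg_abs hg
  refine integrable_of_norm_le_exp ((Complex.continuous_ofReal).mul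
    (continuous_cosTailFull hg.1.continuous hg.2)) (b := 1 / 4) (C := 4 * C) (by norm_num) fun c => ?_
  rw [norm_mul, Complex.norm_real, Real.norm_eq_abs]
  have he : Real.exp (-|c| / 2) = Real.exp (-|c| / 4) * Real.exp (-(1 / 4) * |c|) := by
    rw [← Real.exp_add]; ring_nf
  calc |c| * ‖cosTailFull g c‖ ≤ |c| * (C * Real.exp (-|c| / 2)) :=
        mul_le_mul_of_nonneg_left (hC c) (abs_nonneg c)
    _ = C * (|c| * Real.exp (-|c| / 4)) * Real.exp (-(1 / 4) * |c|) := by rw [he]; ring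
    _ ≤ C * 4 * Real.exp (-(1 / 4) * |c|) := by
        refine mul_le_mul_of_nonneg_right ?_ (Real.exp_pos _).le
        exact mul_le_mul_of_nonneg_left (abs_mul_exp_neg_le c) hC0
    _ = 4 * C * Real.exp (-(1 / 4) * |c|) := by ring

/-- `T ∈ L²`. [cite: ConnesConsani2021, §2 Prop. 2.2 (iii) proof p. 10] -/
theorem memLp_two_cosTailFull : MemLp (cosTailFull g) 2 := by
  obtain ⟨C, hC0, hC⟩ := norm_cosTailFull_le_exp_neg_abs hg
  have hc := continuous_cosTailFull hg.1.continuous hg.2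
  refine (memLp_two_iff_integrable_sq_norm hc.aestronglyMeasurable).2 ?_
  refine integrable_of_norm_le_exp (hc.norm.pow 2) (b := 1) (C := C ^ 2) one_pos fun c => ?_
  rw [Real.norm_eq_abs, abs_of_nonneg (by positivity)]
  have he : Real.exp (-1 * |c|) = Real.exp (-|c| / 2) ^ 2 := by
    rw [sq, ← Real.exp_add]; ring_nf
  rw [he, ← mul_pow]
  exact pow_le_pow_left₀ (norm_nonneg _) (hC c) 2

/-- `c T(c) ∈ L²`. [cite: ConnesConsani2021, §2 Prop. 2.2 (iii) proof p. 10] -/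
theorem memLp_two_mul_cosTailFull : MemLp (fun c : ℝ => (c : ℂ) * cosTailFull g c) 2 := by
  obtain ⟨C, hC0, hC⟩ := norm_cosTailFull_le_exp_neg_abs hg
  have hc : Continuous fun c : ℝ => (c : ℂ) * cosTailFull g c :=
    Complex.continuous_ofReal.mul (continuous_cosTailFull hg.1.continuous hg.2)
  refine (memLp_two_iff_integrable_sq_norm hc.aestronglyMeasurable).2 ?_
  refine integrable_of_norm_le_exp (hc.norm.pow 2) (b := 1 / 2) (C := (4 * C) ^ 2) (by norm_num)
    fun c => ?_
  rw [Real.norm_eq_abs, abs_of_nonneg (by positivity), norm_mul, Complex.norm_real, Real.norm_eq_abs]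
  have h1 : |c| * ‖cosTailFull g c‖ ≤ 4 * C * Real.exp (-|c| / 4) := by
    have he : Real.exp (-|c| / 2) = Real.exp (-|c| / 4) * Real.exp (-|c| / 4) := by
      rw [← Real.exp_add]; ring_nf
    calc |c| * ‖cosTailFull g c‖ ≤ |c| * (C * Real.exp (-|c| / 2)) :=
          mul_le_mul_of_nonneg_left (hC c) (abs_nonneg c)
      _ = C * (|c| * Real.exp (-|c| / 4)) * Real.exp (-|c| / 4) := by rw [he]; ring
      _ ≤ C * 4 * Real.exp (-|c| / 4) := by
          refine mul_le_mul_of_nonneg_right ?_ (Real.exp_pos _).le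
          exact mul_le_mul_of_nonneg_left (abs_mul_exp_neg_le c) hC0
      _ = 4 * C * Real.exp (-|c| / 4) := by ring
  have he : Real.exp (-(1 / 2) * |c|) = Real.exp (-|c| / 4) ^ 2 := by
    rw [sq, ← Real.exp_add]; ring_nf
  rw [he, ← mul_pow]
  exact pow_le_pow_left₀ (by positivity) h1 2

/-- `c ‖T(c)‖² ∈ L¹` (the left-hand side of the logarithmic moment). [cite: ConnesConsani2021, §2 Prop. 2.2 (iii) proof p. 10] -/
theorem integrable_mul_norm_sq_cosTailFull : Integrable fun c : ℝ => c * ‖cosTailFull g c‖ ^ 2 := by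
  have h1 := integrable_mul_cosTailFull hg
  have h2 := integrable_cosTailFull hg
  have hc := continuous_cosTailFull hg.1.continuous hg.2
  -- `|c|‖T‖² = ‖cT‖·‖T‖ ≤ (‖cT‖² + ‖T‖²)/2`
  have h3 : Integrable fun c : ℝ => ‖(c : ℂ) * cosTailFull g c‖ ^ 2 :=
    (memLp_two_iff_integrable_sq_norm h1.aestronglyMeasurable).1 (memLp_two_mul_cosTailFull hg)
  have h4 : Integrable fun c : ℝ => ‖cosTailFull g c‖ ^ 2 :=
    (memLp_two_iff_integrable_sq_norm h2.aestronglyMeasurable).1 (memLp_two_cosTailFull hg)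
  refine Integrable.mono' ((h3.add h4).div_const 2)
    ((continuous_id.mul (hc.norm.pow 2)).aestronglyMeasurable) (Eventually.of_forall fun c => ?_)
  simp only [Pi.add_apply, norm_mul, Complex.norm_real, Real.norm_eq_abs]
  rw [abs_of_nonneg (by positivity : (0:ℝ) ≤ ‖cosTailFull g c‖ ^ 2), mul_pow, sq_abs]
  nlinarith [mul_nonneg (sq_nonneg (|c| - 1)) (sq_nonneg ‖cosTailFull g c‖), abs_nonneg c,
    norm_nonneg (cosTailFull g c), sq_abs c]

end Integrability

/-! ## §6. Generic `mulFourier` calculus on `L¹ ∩ L²`: continuity, `t`-derivative, Plancherel, polarization -/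

/-- The phase `e^{−itx}` has modulus one. [folklore] -/
private theorem norm_cexp_neg_I_mul (t x : ℝ) : ‖cexp (-(I * (t : ℂ) * (x : ℂ)))‖ = 1 := by
  rw [show (-(I * (t : ℂ) * (x : ℂ))) = ((-(t * x) : ℝ) : ℂ) * I by push_cast; ring,
    Complex.norm_exp_ofReal_mul_I]

/-- `ĥ` is continuous for `h ∈ L¹`. [cite: ConnesConsani2021, App. A p. 30] -/
theorem continuous_mulFourier_of_integrable {h : ℝ → ℂ} (hh : Integrable h) :
    Continuous fun t : ℝ => mulFourier h t := by
  show Continuous fun t : ℝ => ∫ x : ℝ, h x * cexp (-(I * (t : ℂ) * (x : ℂ)))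
  refine continuous_of_dominated (F := fun (t x : ℝ) => h x * cexp (-(I * (t : ℂ) * (x : ℂ))))
    (bound := fun x => ‖h x‖) (fun t => ?_) (fun t => ?_) hh.norm ?_
  · have hc : Continuous fun x : ℝ => cexp (-(I * (t : ℂ) * (x : ℂ))) := by fun_prop
    exact hh.1.mul hc.aestronglyMeasurable
  · exact Eventually.of_forall fun x => by
      show ‖h x * cexp (-(I * (t : ℂ) * (x : ℂ)))‖ ≤ ‖h x‖
      rw [norm_mul, norm_cexp_neg_I_mul, mul_one]
  · exact Eventually.of_forall fun x => by fun_prop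

/-- **`d/dt ĥ(t) = −i·(x h)^(t)`** for `h, x h ∈ L¹` (differentiation under the integral sign,
dominated by `|x|‖h(x)‖`). [cite: ConnesConsani2021, App. A p. 30] -/
theorem hasDerivAt_mulFourier {h : ℝ → ℂ} (hh : Integrable h)
    (hxh : Integrable fun x : ℝ => (x : ℂ) * h x) (t₀ : ℝ) :
    HasDerivAt (fun t : ℝ => mulFourier h t)
      (-I * mulFourier (fun x : ℝ => (x : ℂ) * h x) t₀) t₀ := by
  set F : ℝ → ℝ → ℂ := fun t x => h x * cexp (-(I * (t : ℂ) * (x : ℂ))) with hF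
  set F' : ℝ → ℝ → ℂ := fun t x => h x * (-(I * (x : ℂ)) * cexp (-(I * (t : ℂ) * (x : ℂ)))) with hF'
  have hF_meas : ∀ t, AEStronglyMeasurable (F t) volume := fun t => by
    have hc : Continuous fun x : ℝ => cexp (-(I * (t : ℂ) * (x : ℂ))) := by fun_prop
    exact hh.1.mul hc.aestronglyMeasurable
  have hF_int : Integrable (F t₀) := by
    refine hh.norm.mono' (hF_meas t₀) (Eventually.of_forall fun x => ?_)
    simp only [hF]
    rw [norm_mul, norm_cexp_neg_I_mul, mul_one]
  have hF'_meas : AEStronglyMeasurable (F' t₀) volume := by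
    have hc : Continuous fun x : ℝ => -(I * (x : ℂ)) * cexp (-(I * (t₀ : ℂ) * (x : ℂ))) := by fun_prop
    exact hh.1.mul hc.aestronglyMeasurable
  have h_bound : ∀ᵐ x : ℝ, ∀ t ∈ (univ : Set ℝ), ‖F' t x‖ ≤ ‖(x : ℂ) * h x‖ := by
    refine Eventually.of_forall fun x t _ => ?_
    simp only [hF']
    rw [norm_mul, norm_mul, norm_neg, norm_mul, Complex.norm_I, one_mul, norm_cexp_neg_I_mul, mul_one,
      norm_mul, mul_comm]
  have h_diff : ∀ᵐ x : ℝ, ∀ t ∈ (univ : Set ℝ), HasDerivAt (fun t => F t x) (F' t x) t := by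
    refine Eventually.of_forall fun x t _ => ?_
    simp only [hF, hF']
    have h1 : HasDerivAt (fun t : ℝ => -(I * (t : ℂ) * (x : ℂ))) (-(I * (x : ℂ))) t := by
      have := ((hasDerivAt_id t).ofReal_comp.const_mul I).mul_const (x : ℂ)
      simp only [id, Complex.ofReal_one, mul_one] at this
      exact this.neg
    have h2 := (Complex.hasDerivAt_exp _).comp t h1
    have h3 := h2.const_mul (h x)
    refine h3.congr_deriv ?_
    ring
  have key := (hasDerivAt_integral_of_dominated_loc_of_deriv_le (μ := volume) (x₀ := t₀)
    (F := F) (F' := F') (s := univ) Filter.univ_mem (Eventually.of_forall hF_meas) hF_int hF'_meas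
    h_bound hxh.norm h_diff).2
  simp only [hF, hF'] at key
  refine key.congr_deriv ?_
  rw [mulFourier, ← integral_const_mul]
  refine integral_congr_ae (Eventually.of_forall fun x => ?_)
  ring

/-- **Plancherel in the `mulFourier` normalisation**: for `h ∈ L¹ ∩ L²`, `t ↦ ‖ĥ(t)‖²` is integrable and
`∫ ‖ĥ(t)‖² dt = 2π ∫ ‖h‖²` (Titchmarsh Thm. 48, via `PlancherelL1L2.integral_norm_sq_fourierIntegral_eq`
and `t = 2πξ`). [cite: ConnesConsani2021, §2 proof of Cor. 2.3 (ii) ("Parseval") p. 11] -/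
theorem integral_norm_sq_mulFourier {h : ℝ → ℂ} (hh : Integrable h) (hh2 : MemLp h 2) :
    Integrable (fun t : ℝ => ‖mulFourier h t‖ ^ 2) ∧
      ∫ t : ℝ, ‖mulFourier h t‖ ^ 2 = 2 * π * ∫ x : ℝ, ‖h x‖ ^ 2 := by
  have hP := Literature.Analysis.FunctionSpaces.integral_norm_sq_fourierIntegral_eq hh hh2
  have hF := Literature.Analysis.FunctionSpaces.memLp_two_fourierIntegral hh hh2
  have hPi : Integrable (fun ξ : ℝ => ‖𝓕 h ξ‖ ^ 2) := (memLp_two_iff_integrable_sq_norm hF.1).1 hF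
  have h2π : (2 * π : ℝ) ≠ 0 := by positivity
  have e : (fun t : ℝ => ‖mulFourier h t‖ ^ 2) = fun t => (fun ξ : ℝ => ‖𝓕 h ξ‖ ^ 2) (t / (2 * π)) := by
    funext t; simp only [mulFourier_ofReal_eq_fourierIntegral]
  refine ⟨?_, ?_⟩
  · rw [e]; exact hPi.comp_div h2π
  · rw [e, Measure.integral_comp_div (fun ξ : ℝ => ‖𝓕 h ξ‖ ^ 2) (2 * π), hP, smul_eq_mul,
      abs_of_pos (by positivity : (0 : ℝ) < 2 * π)]

/-- `mulFourier` is additive on `L¹`. [folklore] -/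
private theorem mulFourier_add {h k : ℝ → ℂ} (hh : Integrable h) (hk : Integrable k) (t : ℝ) :
    mulFourier (fun x => h x + k x) t = mulFourier h t + mulFourier k t := by
  unfold mulFourier
  rw [← integral_add]
  · refine integral_congr_ae (Eventually.of_forall fun x => ?_); ring
  · refine hh.norm.mono' ?_ (Eventually.of_forall fun x => ?_)
    · exact hh.1.mul (by fun_prop : Continuous fun x : ℝ => cexp (-(I * (t:ℂ) * (x:ℂ)))).aestronglyMeasurable
    · rw [norm_mul, norm_cexp_neg_I_mul, mul_one]
  · refine hk.norm.mono' ?_ (Eventually.of_forall fun x => ?_)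
    · exact hk.1.mul (by fun_prop : Continuous fun x : ℝ => cexp (-(I * (t:ℂ) * (x:ℂ)))).aestronglyMeasurable
    · rw [norm_mul, norm_cexp_neg_I_mul, mul_one]

/-- `mulFourier` is compatible with subtraction on `L¹`. [folklore] -/
private theorem mulFourier_sub {h k : ℝ → ℂ} (hh : Integrable h) (hk : Integrable k) (t : ℝ) :
    mulFourier (fun x => h x - k x) t = mulFourier h t - mulFourier k t := by
  have h1 := mulFourier_add hh hk.neg t
  have e1 : (fun x => h x + (-k) x) = fun x => h x - k x := by funext x; simp [sub_eq_add_neg]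
  have e2 : mulFourier (-k) t = -mulFourier k t := by
    unfold mulFourier; rw [← integral_neg]
    refine integral_congr_ae (Eventually.of_forall fun x => ?_); simp [neg_mul]
  rw [e1, e2] at h1
  rw [h1, sub_eq_add_neg]

/-- The pointwise polarization identity `‖a + b‖² − ‖a − b‖² = 4 Re(conj a · b)`. [folklore] -/
private theorem norm_add_sq_sub_norm_sub_sq' (a b : ℂ) :
    ‖a + b‖ ^ 2 - ‖a - b‖ ^ 2 = 4 * (conj a * b).re := by
  rw [Complex.sq_norm, Complex.sq_norm, Complex.normSq_add, Complex.normSq_sub]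
  simp only [Complex.mul_re, Complex.conj_re, Complex.conj_im]
  ring

/-- `Re(conj a · b)` is dominated by `(‖a‖² + ‖b‖²)/2`, hence integrable when `a, b ∈ L²`. [folklore] -/
private theorem integrable_re_conj_mul {φ ψ : ℝ → ℂ} (hφm : AEStronglyMeasurable φ volume)
    (hψm : AEStronglyMeasurable ψ volume) (hφ : Integrable fun t => ‖φ t‖ ^ 2)
    (hψ : Integrable fun t => ‖ψ t‖ ^ 2) : Integrable fun t => conj (φ t) * ψ t := by
  refine Integrable.mono' ((hφ.add hψ).div_const 2) ((continuous_conj.comp_aestronglyMeasurable hφm).mul hψm)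
    (Eventually.of_forall fun t => ?_)
  rw [norm_mul, Complex.norm_conj]
  simp only [Pi.add_apply]
  nlinarith [sq_nonneg (‖φ t‖ - ‖ψ t‖), norm_nonneg (φ t), norm_nonneg (ψ t)]

/-- **Polarized Plancherel** (`mulFourier` normalisation): for `h, k ∈ L¹ ∩ L²`,
`Re ∫ conj(ĥ) k̂ dt = 2π Re ∫ conj(h) k`. [cite: ConnesConsani2021, §2 proof of Cor. 2.3 (ii) ("Parseval") p. 11] -/
theorem re_integral_conj_mulFourier_mul {h k : ℝ → ℂ} (hh : Integrable h) (hh2 : MemLp h 2)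
    (hk : Integrable k) (hk2 : MemLp k 2) :
    (∫ t : ℝ, conj (mulFourier h t) * mulFourier k t).re = 2 * π * (∫ x : ℝ, conj (h x) * k x).re := by
  -- Plancherel for `h ± k`
  obtain ⟨iP, hP⟩ := integral_norm_sq_mulFourier (h := fun x => h x + k x) (hh.add hk) (hh2.add hk2)
  obtain ⟨iM, hM⟩ := integral_norm_sq_mulFourier (h := fun x => h x - k x) (hh.sub hk) (hh2.sub hk2)
  obtain ⟨ih, -⟩ := integral_norm_sq_mulFourier hh hh2
  obtain ⟨ik, -⟩ := integral_norm_sq_mulFourier hk hk2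
  have hh2i : Integrable fun x : ℝ => ‖h x‖ ^ 2 := (memLp_two_iff_integrable_sq_norm hh.1).1 hh2
  have hk2i : Integrable fun x : ℝ => ‖k x‖ ^ 2 := (memLp_two_iff_integrable_sq_norm hk.1).1 hk2
  have iP' : Integrable fun x : ℝ => ‖h x + k x‖ ^ 2 :=
    (memLp_two_iff_integrable_sq_norm (hh.add hk).1).1 (hh2.add hk2)
  have iM' : Integrable fun x : ℝ => ‖h x - k x‖ ^ 2 :=
    (memLp_two_iff_integrable_sq_norm (hh.sub hk).1).1 (hh2.sub hk2)
  simp_rw [mulFourier_add hh hk] at hP iP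
  simp_rw [mulFourier_sub hh hk] at hM iM
  -- integrability of the cross terms
  have cF : Continuous fun t : ℝ => mulFourier h t := continuous_mulFourier_of_integrable hh
  have cG : Continuous fun t : ℝ => mulFourier k t := continuous_mulFourier_of_integrable hk
  have iX := integrable_re_conj_mul cF.aestronglyMeasurable cG.aestronglyMeasurable ih ik
  have ix := integrable_re_conj_mul hh.1 hk.1 hh2i hk2i
  -- subtract the two Plancherel identities
  have e1 : ∫ t : ℝ, (‖mulFourier h t + mulFourier k t‖ ^ 2 - ‖mulFourier h t - mulFourier k t‖ ^ 2) =
      2 * π * ∫ x : ℝ, (‖h x + k x‖ ^ 2 - ‖h x - k x‖ ^ 2) := by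
    rw [integral_sub iP iM, integral_sub iP' iM', hP, hM]; ring
  simp_rw [norm_add_sq_sub_norm_sub_sq'] at e1
  rw [integral_const_mul, integral_const_mul] at e1
  have r1 : ∫ t : ℝ, (conj (mulFourier h t) * mulFourier k t).re =
      (∫ t : ℝ, conj (mulFourier h t) * mulFourier k t).re := integral_re iX
  have r2 : ∫ x : ℝ, (conj (h x) * k x).re = (∫ x : ℝ, conj (h x) * k x).re := integral_re ix
  rw [r1, r2] at e1
  linarith

/-! ## §7. The derivative of `u_∞` -/

/-- `u_∞′(s) = 2iθ′(s)·u_∞(s)` (`u_∞ = e^{2iθ}`, `θ′ = riemannSiegelThetaDeriv`). [cite: ConnesConsani2021, §1 eq. (14) p. 7; App. B eq. (84) p. 31] -/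
theorem hasDerivAt_archUnitary (s : ℝ) :
    HasDerivAt archUnitary (archUnitary s * (2 * (riemannSiegelThetaDeriv s : ℂ) * I)) s := by
  have h1 : HasDerivAt (fun s : ℝ => 2 * (riemannSiegelTheta s : ℂ) * I)
      (2 * (riemannSiegelThetaDeriv s : ℂ) * I) s :=
    ((hasDerivAt_riemannSiegelTheta_holds s).ofReal_comp.const_mul (2 : ℂ)).mul_const I
  have h2 := (Complex.hasDerivAt_exp _).comp s h1
  exact h2

/-- `conj(u_∞) · u_∞ = 1`. [cite: ConnesConsani2021, §1 p. 9] -/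
private theorem conj_archUnitary_mul_self (s : ℝ) : conj (archUnitary s) * archUnitary s = 1 := by
  rw [← Complex.normSq_eq_conj_mul_self, Complex.normSq_eq_norm_sq, norm_archUnitary]
  norm_num

/-! ## §8. The logarithmic moment: `4∫ c‖T(c)‖² dc = Re W_∞(g ∗ g*) − ∫ σ‖g(σ)‖²dσ` -/

/-- `Re ∫ conj(h)(x·h) = ∫ x ‖h(x)‖²`. [folklore] -/
private theorem re_integral_conj_mul_ofReal_mul (h : ℝ → ℂ) :
    (∫ x : ℝ, conj (h x) * ((x : ℂ) * h x)).re = ∫ x : ℝ, x * ‖h x‖ ^ 2 := by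
  have e : ∀ x : ℝ, conj (h x) * ((x : ℂ) * h x) = ((x * ‖h x‖ ^ 2 : ℝ) : ℂ) := by
    intro x
    rw [← mul_comm (h x), ← mul_assoc, ← Complex.normSq_eq_conj_mul_self, Complex.normSq_eq_norm_sq]
    push_cast; ring
  simp_rw [e]
  rw [integral_complex_ofReal, Complex.ofReal_re]

/-- The weight `t ↦ ‖ĝ(t)‖²·2θ′(t)` is integrable (logarithmic growth of `θ′` against the decay of `ĝ`;
from `integrable_norm_sq_weilMellin_mul_reDigammaQuarter`). [cite: ConnesConsani2021, §2 eq. (30) p. 11] -/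
private theorem integrable_norm_sq_mulFourier_mul_thetaDeriv (hg : IsWeilTest g) :
    Integrable fun t : ℝ => ‖mulFourier g t‖ ^ 2 * (2 * riemannSiegelThetaDeriv t) := by
  have hA := integrable_norm_sq_weilMellin_mul_reDigammaQuarter hg
  have hB := (integrable_norm_sq_weilMellin_half_line hg).mul_const (Real.log π)
  have hAB := (hA.sub hB).comp_neg
  refine hAB.congr (Eventually.of_forall fun t => ?_)
  simp only [Pi.sub_apply]
  have hm : mulFourier g t = weilMellin g (1 / 2 + ((-t : ℝ) : ℂ) * I) := by
    rw [mulFourier_eq_weilMellin]; congr 1; push_cast; ring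
  have hθ : 2 * riemannSiegelThetaDeriv t =
      Literature.Analysis.SpecialFunctions.reDigammaQuarter (-t) - Real.log π := by
    rw [← riemannSiegelThetaDeriv_neg_holds t, riemannSiegelThetaDeriv,
      Literature.Analysis.SpecialFunctions.reDigammaQuarter]
    ring
  rw [hm, hθ]; ring

/-- **The logarithmic moment of the cosine transform** (the `W_∞` half of the Hilbert–Schmidt identity
behind Prop. 2.2 (iii)): for a test function `g` and `T = cosTailFull g`,
`4 ∫_ℝ c ‖T(c)‖² dc = Re W_∞(g ∗ g*) − ∫ σ ‖g(σ)‖² dσ`, with `W_∞ = archW` (Bombieri's explicit form).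
Proof on the spectral side: `(cT)^ = i dT̂/dt` with `T̂ = ½u_∞(−·)ĝ(−·)` (Lemma 1.3),
`u_∞′ = 2iθ′u_∞`, `ĝ′ = −i(σg)^`, so `conj(T̂)(cT)^ = ¼(2θ′|ĝ|² − conj(ĝ)(σg)^)(−t)`; polarized
Plancherel on both sides and `W_∞(g ∗ g*) = (1/2π)∫|ĝ|²2θ′` (eq. (30), `archW_eq_integral_mulFourier_thetaDeriv`
with `(g ∗ g*)^ = |ĝ|²`). [cite: ConnesConsani2021, §2 Prop. 2.2 (iii) p. 10 and eq. (30) p. 11; §1 Lemma 1.3, Prop. 1.5 (iii)–(iv) pp. 7–9] -/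
theorem cosTailFull_logMoment (hg : IsWeilTest g) :
    4 * ∫ c : ℝ, c * ‖cosTailFull g c‖ ^ 2 =
      (archW (weilConv g (weilReflect g))).re - ∫ σ : ℝ, σ * ‖g σ‖ ^ 2 := by
  -- the players and their integrability
  have hT1 := integrable_cosTailFull hg
  have hT2 := memLp_two_cosTailFull hg
  have hcT1 := integrable_mul_cosTailFull hg
  have hcT2 := memLp_two_mul_cosTailFull hg
  have hgi : Integrable g := hg.1.continuous.integrable_of_hasCompactSupport hg.2
  have hg2 : MemLp g 2 := hg.1.continuous.memLp_of_hasCompactSupport hg.2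
  have hxg : IsWeilTest fun x : ℝ => (x : ℂ) * g x := hg.ofReal_mul
  have hxgi : Integrable fun x : ℝ => (x : ℂ) * g x :=
    hxg.1.continuous.integrable_of_hasCompactSupport hxg.2
  have hxg2 : MemLp (fun x : ℝ => (x : ℂ) * g x) 2 := hxg.1.continuous.memLp_of_hasCompactSupport hxg.2
  -- Step A: polarized Plancherel for `T` and `cT`
  have hA := re_integral_conj_mulFourier_mul hT1 hT2 hcT1 hcT2
  rw [re_integral_conj_mul_ofReal_mul] at hA
  -- Step B: `(cT)^(t)` from the derivative of `T̂ = ½u(−·)ĝ(−·)`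
  have hX : ∀ t : ℝ, mulFourier (fun c : ℝ => (c : ℂ) * cosTailFull g c) t =
      (1 / 2 : ℂ) * (((2 * riemannSiegelThetaDeriv (-t) : ℝ) : ℂ) * archUnitary (-t) *
        mulFourier g (((-t : ℝ)) : ℂ)) -
      (1 / 2 : ℂ) * (archUnitary (-t) * mulFourier (fun x : ℝ => (x : ℂ) * g x) (((-t : ℝ)) : ℂ)) := by
    intro t
    have hΦ' := hasDerivAt_mulFourier hT1 hcT1 t
    have hΦΨ : (fun t : ℝ => mulFourier (cosTailFull g) t) = fun t : ℝ =>
        (1 / 2 : ℂ) * archUnitary (-t) * mulFourier g (((-t : ℝ)) : ℂ) := by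
      funext t; rw [mulFourier_cosTailFull hg]; push_cast; rfl
    rw [hΦΨ] at hΦ'
    -- derivative of the right-hand side
    have hu := ((hasDerivAt_archUnitary (-t)).scomp t (hasDerivAt_neg t))
    have hĝ := ((hasDerivAt_mulFourier hgi hxgi (-t)).scomp t (hasDerivAt_neg t))
    have hΨ' := ((hu.mul hĝ).const_mul (1 / 2 : ℂ))
    have hΨ'' : HasDerivAt (fun t : ℝ => (1 / 2 : ℂ) * archUnitary (-t) * mulFourier g (((-t : ℝ)) : ℂ))
        ((1 / 2 : ℂ) * ((-1 : ℝ) • (archUnitary (-t) * (2 * (riemannSiegelThetaDeriv (-t) : ℂ) * I)) *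
          mulFourier g (((-t : ℝ)) : ℂ) + archUnitary (-t) *
          ((-1 : ℝ) • (-I * mulFourier (fun x : ℝ => (x : ℂ) * g x) (((-t : ℝ)) : ℂ))))) t := by
      refine hΨ'.congr_of_eventuallyEq (Eventually.of_forall fun s => ?_)
      simp only [Function.comp_def, mul_assoc, Pi.mul_apply]
    have huniq := hΦ'.unique hΨ''
    simp only [Complex.real_smul] at huniq
    -- `−I·X = D` ⇒ `X = I·D`
    have hXD := congrArg (fun z => I * z) huniq
    simp only [← mul_assoc, mul_neg, Complex.I_mul_I, neg_neg, one_mul] at hXD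
    rw [hXD]
    push_cast
    linear_combination ((1 / 2 : ℂ) * (archUnitary (-t) *
        mulFourier (fun x : ℝ => (x : ℂ) * g x) (-(t : ℂ)) -
        2 * (riemannSiegelThetaDeriv (-t) : ℂ) * archUnitary (-t) * mulFourier g (-(t : ℂ)))) *
      Complex.I_mul_I
  -- Step C: the pointwise product `conj(T̂)(cT)^`
  have hP : ∀ t : ℝ, conj (mulFourier (cosTailFull g) t) * mulFourier (fun c : ℝ => (c : ℂ) * cosTailFull g c) t
      = (1 / 4 : ℂ) * (((‖mulFourier g (((-t : ℝ)) : ℂ)‖ ^ 2 * (2 * riemannSiegelThetaDeriv (-t)) : ℝ) : ℂ))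
        - (1 / 4 : ℂ) * (conj (mulFourier g (((-t : ℝ)) : ℂ)) *
            mulFourier (fun x : ℝ => (x : ℂ) * g x) (((-t : ℝ)) : ℂ)) := by
    intro t
    rw [hX t, mulFourier_cosTailFull hg]
    have h1 := conj_archUnitary_mul_self (-t)
    have h2 : conj (mulFourier g (((-t : ℝ)) : ℂ)) * mulFourier g (((-t : ℝ)) : ℂ) =
        ((‖mulFourier g (((-t : ℝ)) : ℂ)‖ ^ 2 : ℝ) : ℂ) := by
      rw [← Complex.normSq_eq_conj_mul_self, Complex.normSq_eq_norm_sq]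
    push_cast at h2 ⊢
    simp only [map_mul, map_div₀, map_one, map_ofNat]
    linear_combination ((1 / 4 : ℂ) * (2 * (riemannSiegelThetaDeriv (-t) : ℂ)) *
      conj (mulFourier g (-(t : ℂ))) * mulFourier g (-(t : ℂ))) * h1 +
      ((1 / 4 : ℂ) * (2 * (riemannSiegelThetaDeriv (-t) : ℂ))) * h2 -
      ((1 / 4 : ℂ) * conj (mulFourier g (-(t : ℂ))) * mulFourier (fun x : ℝ => (x : ℂ) * g x) (-(t : ℂ))) * h1
  -- Step D: integrate, reflect `t ↦ −t`, and take real parts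
  have hW := integrable_norm_sq_mulFourier_mul_thetaDeriv hg
  obtain ⟨iG, -⟩ := integral_norm_sq_mulFourier hgi hg2
  obtain ⟨iXG, -⟩ := integral_norm_sq_mulFourier hxgi hxg2
  have iC := integrable_re_conj_mul (continuous_mulFourier_of_integrable hgi).aestronglyMeasurable
    (continuous_mulFourier_of_integrable hxgi).aestronglyMeasurable iG iXG
  have hD : ∫ t : ℝ, conj (mulFourier (cosTailFull g) t) *
      mulFourier (fun c : ℝ => (c : ℂ) * cosTailFull g c) t =
      (1 / 4 : ℂ) * ((∫ t : ℝ, ‖mulFourier g t‖ ^ 2 * (2 * riemannSiegelThetaDeriv t) : ℝ) : ℂ) -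
      (1 / 4 : ℂ) * ∫ t : ℝ, conj (mulFourier g t) * mulFourier (fun x : ℝ => (x : ℂ) * g x) t := by
    simp_rw [hP]
    rw [integral_sub, integral_const_mul, integral_const_mul, integral_complex_ofReal]
    · congr 2
      · rw [← integral_neg_eq_self (fun t : ℝ => ‖mulFourier g t‖ ^ 2 * (2 * riemannSiegelThetaDeriv t))
          volume]
      · rw [← integral_neg_eq_self (fun t : ℝ => conj (mulFourier g t) *
          mulFourier (fun x : ℝ => (x : ℂ) * g x) t) volume]
    · exact ((hW.comp_neg).ofReal).const_mul _
    · exact (iC.comp_neg).const_mul _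
  have hre := congrArg Complex.re hD
  rw [hA] at hre
  simp only [Complex.sub_re, Complex.mul_re, Complex.ofReal_re, Complex.ofReal_im, mul_zero, sub_zero,
    Complex.div_re, Complex.one_re] at hre
  rw [re_integral_conj_mulFourier_mul hgi hg2 hxgi hxg2, re_integral_conj_mul_ofReal_mul] at hre
  -- Step E: `W_∞(g ∗ g*) = (1/2π) ∫ |ĝ|² 2θ′`
  have hF := hg.weilConv hg.weilReflect
  have hWinf : (archW (weilConv g (weilReflect g))).re =
      1 / (2 * π) * ∫ t : ℝ, ‖mulFourier g t‖ ^ 2 * (2 * riemannSiegelThetaDeriv t) := by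
    rw [archW_eq_integral_mulFourier_thetaDeriv hF]
    simp_rw [mulFourier_autocorr hg]
    have e : ∀ t : ℝ, ((‖mulFourier g t‖ ^ 2 : ℝ) : ℂ) * ((2 * riemannSiegelThetaDeriv t : ℝ) : ℂ) =
        ((‖mulFourier g t‖ ^ 2 * (2 * riemannSiegelThetaDeriv t) : ℝ) : ℂ) := fun t => by push_cast; ring
    simp_rw [e]
    rw [integral_complex_ofReal, show (1 / (2 * π) : ℂ) = ((1 / (2 * π) : ℝ) : ℂ) by push_cast; ring,
      ← Complex.ofReal_mul, Complex.ofReal_re]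
  rw [hWinf]
  have hπ : (π : ℝ) ≠ 0 := Real.pi_ne_zero
  field_simp
  field_simp at hre
  norm_num at hre ⊢
  linarith

end Literature.NumberTheory.ConnesConsani2021

end
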